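import Summits.AtomisticToContinuum.Crystallization.Theorems.ThreeConeCertificateSlackRigidityPricedFloorsProb
import Summits.AtomisticToContinuum.Crystallization.Theorems.ThreeConeCertificateSlackRigidityPricedFloorsStationarity
import Summits.AtomisticToContinuum.Crystallization.Theorems.PalmUnimodularRigidityMinimiserShellsEnergyFloorC
import Summits.AtomisticToContinuum.Crystallization.Theorems.PalmUnimodularRigidityCruxesToPalmRigidity
import HarnessLib

/-!
# `SlackRigidity` (stmt-AtomisticToContinuum-11960), line `priced-floors-palm-exactification`, stub S3
# (`stub_layeredMeanSelection`): abstract probabilistic lemmas, II (for the increment argument)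

Lead c19, S3 probabilistic core, part 4 (pure measure theory).

* `integral_eq_of_transport` — a transport identity `∫⁻ ofReal(G+M) dP = ∫⁻ (∫⁻ Ωs μ y · ofReal(G(θ_y μ)+M) dμ) dP`
  whose transported integrand is identified a.e. with `ofReal(L μ + M)` for a bounded MEASURABLE `L`
  gives the Bochner identity `∫ G dP = ∫ L dP` (used with `G = 2h` and `L =` a window average of layer
  energies, which is a measurable functional of the sample);
* `lms_ae_zero_of_integral_le_div` (registered) — a nonnegative bounded measurable functional whose
  mean is `≤ C/(2n+1)` for every `n` vanishes almost surely (used with the symmetric increment-jump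
  functional);
* `lms_increments_ae_zero` (registered) — THE MEAN INCREMENT ARGUMENT, with every geometric input
  abstracted: for each `n`, three transport identities (the uniform layer transport over the `2n+1`
  layers around the root applied to `2h` and to the jump functional `D`, and the symmetrised shifted
  transport applied to `2h`) identify `E[2h]` with the means of the window averages `A`, `B` of the
  actual layer energies and `E[D]` with the mean of a window average `Dt ≤ 2V` of squared increment
  jumps, while CONVEXITY of the block energy in the increments (`LayeredHull.stub_convexity` through
  `clo_block_decomposition` and the window bound for the midpoint competitors) gives pointwise
  `A + B ≥ 4e* − C/(2n+1) + κ V`; with `E[2h] ≤ 2e*` this forces `κ E[V] ≤ C/(2n+1)`, hence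
  `E[D] ≤ 2C/(κ(2n+1))` for every `n`, so `D = 0` a.s.: ALL LAYER SPACINGS NEXT TO THE ROOT AGREE.

All `[folklore]`.
-/

noncomputable section

open MeasureTheory Filter Set
open scoped ENNReal BigOperators Topology

namespace Summit.AtomisticToContinuum.Crystallization.Theorems.SlackRigidityPricedFloorsProb

open Summit.AtomisticToContinuum.Crystallization.Theorems.SlackRigidityPricedFloors

variable {P : Measure (Measure E3)}

/-- **From a transport identity with identified image to a Bochner identity.** [folklore] -/
theorem integral_eq_of_transport [IsProbabilityMeasure P] {G L : Measure E3 → ℝ} (hG : Measurable G)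
    (hL : Measurable L) {M : ℝ} (hGb : ∀ᵐ μ ∂P, |G μ| ≤ M) (hLb : ∀ᵐ μ ∂P, |L μ| ≤ M)
    {Ωs : Measure E3 → E3 → ℝ≥0∞}
    (hT : ∫⁻ μ, ENNReal.ofReal (G μ + M) ∂P =
      ∫⁻ μ, ∫⁻ y, Ωs μ y * ENNReal.ofReal (G (μ.map (fun z => z - y)) + M) ∂μ ∂P)
    (hid : ∀ᵐ μ ∂P, ∫⁻ y, Ωs μ y * ENNReal.ofReal (G (μ.map (fun z => z - y)) + M) ∂μ =
      ENNReal.ofReal (L μ + M)) :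
    ∫ μ, G μ ∂P = ∫ μ, L μ ∂P := by
  have hGi : Integrable G P := integrable_of_abs_le hG hGb
  have hLi : Integrable L P := integrable_of_abs_le hL hLb
  have hGM : Integrable (fun μ => G μ + M) P := hGi.add (integrable_const M)
  have hLM : Integrable (fun μ => L μ + M) P := hLi.add (integrable_const M)
  have hGnn : 0 ≤ᵐ[P] fun μ => G μ + M := by
    filter_upwards [hGb] with μ hμ
    show (0 : ℝ) ≤ G μ + M
    linarith [neg_abs_le (G μ)]
  have hLnn : 0 ≤ᵐ[P] fun μ => L μ + M := by
    filter_upwards [hLb] with μ hμ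
    show (0 : ℝ) ≤ L μ + M
    linarith [neg_abs_le (L μ)]
  have h1 : ∫⁻ μ, ENNReal.ofReal (G μ + M) ∂P = ∫⁻ μ, ENNReal.ofReal (L μ + M) ∂P := by
    rw [hT]
    exact lintegral_congr_ae hid
  rw [← ofReal_integral_eq_lintegral_ofReal hGM hGnn, ← ofReal_integral_eq_lintegral_ofReal hLM hLnn] at h1
  have h2 := (ENNReal.ofReal_eq_ofReal_iff (integral_nonneg_of_ae hGnn) (integral_nonneg_of_ae hLnn)).1 h1
  rw [integral_add hGi (integrable_const M), integral_add hLi (integrable_const M)] at h2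
  linarith

/-- **Vanishing from a decaying mean** (registered sub-goal `lms_ae_zero_of_integral_le_div`): a
nonnegative bounded measurable functional with `∫ D dP ≤ C/(2n+1)` for every `n` is `0` a.s.
[folklore] -/
theorem lms_ae_zero_of_integral_le_div : ∀ (P : Measure (Measure E3)), IsProbabilityMeasure P → ∀ (D : Measure E3 → ℝ), Measurable D → ∀ (K C : ℝ), (∀ᵐ μ ∂P, 0 ≤ D μ ∧ D μ ≤ K) → (∀ n : ℕ, (∫ μ, D μ ∂P) ≤ C / (2 * n + 1)) → ∀ᵐ μ ∂P, D μ = 0 := by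
  intro P hP D hD K C hDK hmean
  have hDi : Integrable D P := integrable_of_abs_le hD (M := K) (by
    filter_upwards [hDK] with μ hμ; rw [abs_of_nonneg hμ.1]; exact hμ.2)
  have hnn : 0 ≤ᵐ[P] D := by
    filter_upwards [hDK] with μ hμ using hμ.1
  -- `∫ D ≤ 0`
  have hle : ∫ μ, D μ ∂P ≤ 0 := by
    refine le_of_forall_pos_le_add fun ε hε => ?_
    rw [zero_add]
    by_cases hC : C ≤ 0
    · have := hmean 0
      have h0 : C / (2 * (0 : ℕ) + 1) = C := by norm_num
      linarith
    · push Not at hC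
      obtain ⟨n, hn⟩ := exists_nat_gt (C / ε)
      have hpos : (0 : ℝ) < 2 * n + 1 := by positivity
      have : C / (2 * n + 1) ≤ ε := by
        rw [div_le_iff₀ hpos]
        rw [div_lt_iff₀ hε] at hn
        nlinarith
      linarith [hmean n]
  have h0 : ∫ μ, D μ ∂P = 0 := le_antisymm hle (integral_nonneg_of_ae hnn)
  have h5 := (integral_eq_zero_iff_of_nonneg_ae hnn hDi).1 h0
  filter_upwards [h5] with μ hμ using hμ

/-! ## The mean increment argument (abstract) -/

open Literature.Probability.Process
open Literature.MathematicalPhysics.StatisticalMechanics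
open Summit.AtomisticToContinuum.Crystallization.Theorems.SlackRigidityPricedFloorsStationarity
open Summit.AtomisticToContinuum.Crystallization.Theorems.MinimiserShells.Negative.LoadBearing (eStar)
open Summit.AtomisticToContinuum.Crystallization.Theorems.PalmUnimodularRigidityMinimiserShells.EnergyFloor
  (rootEnergy' measurable_rootEnergy' rootEnergy'_eq_of_hc rootEnergy'_bounds_of_hc)

/-- **Mean increment argument** (registered sub-goal `lms_increments_ae_zero`): see the module
docstring.  The hypothesis for each `n` packages: measurable bounded window functionals `A, B`
(averages of actual layer energies over the centred window and over the symmetrised shifted windows),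
`V ≥ 0` (average of squared increment jumps) and `Dt ≥ 0` (transported jump functional), two
transport-kernel pairs `(Ωr, Ωs)`, `(Ωr', Ωs')` with balance and covariance, the three a.e.
identifications of the transported integrands, the convexity inequality `4e* − C/(2n+1) + κV ≤ A + B`
and `Dt ≤ 2V`. [folklore] -/
theorem lms_increments_ae_zero : ∀ (δ : ℝ), 0 < δ → ∀ (P : Measure (Measure E3)), IsProbabilityMeasure P → IsMinimisingLaw δ P → ∀ (D : Measure E3 → ℝ), Measurable D → ∀ (K κ C : ℝ), 0 < κ → 0 ≤ C → (∀ᵐ μ ∂P, 0 ≤ D μ ∧ D μ ≤ K) → (∀ᵐ μ ∂P, |2 * rootEnergy lennardJones μ| ≤ K) → (∀ n : ℕ, ∃ (A B V Dt : Measure E3 → ℝ) (Ωr Ωs Ωr' Ωs' : Measure E3 → E3 → ℝ≥0∞), Measurable A ∧ Measurable B ∧ Measurable V ∧ Measurable Dt ∧ (∀ᵐ μ ∂P, |A μ| ≤ K) ∧ (∀ᵐ μ ∂P, |B μ| ≤ K) ∧ (∀ᵐ μ ∂P, 0 ≤ V μ ∧ V μ ≤ K) ∧ (∀ᵐ μ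 ∂P, 0 ≤ Dt μ ∧ Dt μ ≤ K) ∧ Measurable (Function.uncurry Ωr) ∧ (∀ᵐ μ ∂P, ∫⁻ y, Ωr μ y ∂μ = 1) ∧ (∀ᵐ μ ∂P, ∀ y : E3, μ {y} ≠ 0 → Ωr (μ.map (fun z => z - y)) (-y) = Ωs μ y) ∧ Measurable (Function.uncurry Ωr') ∧ (∀ᵐ μ ∂P, ∫⁻ y, Ωr' μ y ∂μ = 1) ∧ (∀ᵐ μ ∂P, ∀ y : E3, μ {y} ≠ 0 → Ωr' (μ.map (fun z => z - y)) (-y) = Ωs' μ y) ∧ (∀ᵐ μ ∂P, ∫⁻ y, Ωs μ y * ENNReal.ofReal (2 * rootEnergy lennardJones (μ.map (fun z => z - y)) + K) ∂μ = ENNReal.ofReal (A μ + K)) ∧ (∀ᵐ μ ∂P, ∫⁻ y, Ωs' μ y * ENNReal.ofReal (2 * rootEnergy lennardJones (μ.map (fun z => z - y)) + K) ∂μ = ENNReal.ofReal (B μ + K)) ∧ (∀ᵐ μ ∂P, ∫⁻ y, Ωs μ y * ENNReal.ofReal (D (μ.map (fun z => z - y)) + K) ∂μ = ENNReal.ofReal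 (Dt μ + K)) ∧ (∀ᵐ μ ∂P, 4 * eStar - C / (2 * n + 1) + κ * V μ ≤ A μ + B μ) ∧ (∀ᵐ μ ∂P, Dt μ ≤ 2 * V μ)) → ∀ᵐ μ ∂P, D μ = 0 := by
  intro δ hδ P hP hlaw D hDm K κ C hκ hC hDK hHK hT
  obtain ⟨hcore, hstat, hE⟩ := hlaw
  -- the doubled root energy as a bounded measurable functional
  set H : Measure E3 → ℝ := fun μ => 2 * rootEnergy' μ with hHdef
  have hHm : Measurable H := measurable_rootEnergy'.const_mul 2
  have hHeq : ∀ᵐ μ ∂P, H μ = 2 * rootEnergy lennardJones μ := by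
    filter_upwards [hcore] with μ hμ
    simp only [hHdef, rootEnergy'_eq_of_hc hδ hμ, rootEnergy_def]
  have hHb : ∀ᵐ μ ∂P, |H μ| ≤ K := by
    filter_upwards [hHeq, hHK] with μ h1 h2
    rwa [h1]
  have hHint : Integrable H P := integrable_of_abs_le hHm hHb
  have hHE : ∫ μ, H μ ∂P ≤ 2 * eStar := by
    rw [integral_congr_ae hHeq, integral_const_mul]
    linarith
  -- `H = 2h` also at every re-rooted sample (root-to-everywhere)
  have hHeq' : ∀ᵐ μ ∂P, ∀ y : E3, μ {y} ≠ 0 →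
      H (μ.map (fun z => z - y)) = 2 * rootEnergy lennardJones (μ.map (fun z => z - y)) := by
    have hlf : ∀ᵐ μ ∂P, ∀ n : ℕ, μ ((fun z : E3 => ⌊‖z‖⌋₊) ⁻¹' {n}) < ⊤ := by
      filter_upwards [hcore] with μ hc n
      obtain ⟨S, -, hsep, rfl⟩ := hc
      exact PalmUnimodularRigidity.count_restrict_floorNorm_preimage_lt_top hδ hsep n
    exact PalmUnimodularRigidity.ae_forall_map_sub_of_ae hstat hlf hHeq
  -- the mean of `D` decays like `1/(2n+1)`
  have hmean : ∀ n : ℕ, (∫ μ, D μ ∂P) ≤ (2 * C / κ) / (2 * n + 1) := by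
    intro n
    obtain ⟨A, B, V, Dt, Ωr, Ωs, Ωr', Ωs', hAm, hBm, hVm, hDtm, hAb, hBb, hVb, hDtb, hΩm, hbal, hcov,
      hΩm', hbal', hcov', hidA, hidB, hidD, hconv, hDV⟩ := hT n
    have hDb : ∀ᵐ μ ∂P, |D μ| ≤ K := by
      filter_upwards [hDK] with μ h; rw [abs_of_nonneg h.1]; exact h.2
    have hDtb' : ∀ᵐ μ ∂P, |Dt μ| ≤ K := by
      filter_upwards [hDtb] with μ h; rw [abs_of_nonneg h.1]; exact h.2
    have hVi : Integrable V P := integrable_of_abs_le hVm (M := K) (by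
      filter_upwards [hVb] with μ h; rw [abs_of_nonneg h.1]; exact h.2)
    have hAi : Integrable A P := integrable_of_abs_le hAm hAb
    have hBi : Integrable B P := integrable_of_abs_le hBm hBb
    have hDi : Integrable D P := integrable_of_abs_le hDm hDb
    have hDti : Integrable Dt P := integrable_of_abs_le hDtm hDtb'
    -- the three transport identities
    have htrH := lms_lintegral_eq_transport δ hδ P hstat hcore Ωr Ωs hΩm hbal hcov
      (fun μ => ENNReal.ofReal (H μ + K)) (ENNReal.measurable_ofReal.comp (hHm.add_const K))
    have htrH' := lms_lintegral_eq_transport δ hδ P hstat hcore Ωr' Ωs' hΩm' hbal' hcov'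
      (fun μ => ENNReal.ofReal (H μ + K)) (ENNReal.measurable_ofReal.comp (hHm.add_const K))
    have htrD := lms_lintegral_eq_transport δ hδ P hstat hcore Ωr Ωs hΩm hbal hcov
      (fun μ => ENNReal.ofReal (D μ + K)) (ENNReal.measurable_ofReal.comp (hDm.add_const K))
    -- identifications with `H` in place of `2h`
    have swap : ∀ {Ω : Measure E3 → E3 → ℝ≥0∞} {L : Measure E3 → ℝ},
        (∀ᵐ μ ∂P, ∫⁻ y, Ω μ y * ENNReal.ofReal (2 * rootEnergy lennardJones (μ.map (fun z => z - y)) + K) ∂μ =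
          ENNReal.ofReal (L μ + K)) →
        ∀ᵐ μ ∂P, ∫⁻ y, Ω μ y * ENNReal.ofReal (H (μ.map (fun z => z - y)) + K) ∂μ =
          ENNReal.ofReal (L μ + K) := by
      intro Ω L hid
      filter_upwards [hid, hHeq', hcore] with μ h1 h2 hc
      rw [← h1]
      obtain ⟨S, -, hsep, rfl⟩ := hc
      refine lintegral_count_restrict_congr
        (MinimiserShells.Negative.Rootedness.countable_of_separated hδ hsep) fun y hy => ?_
      rw [h2 y ((count_restrict_singleton_ne_zero_iff S y).2 hy)]
    have hIA : ∫ μ, H μ ∂P = ∫ μ, A μ ∂P :=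
      integral_eq_of_transport hHm hAm hHb hAb htrH (swap hidA)
    have hIB : ∫ μ, H μ ∂P = ∫ μ, B μ ∂P :=
      integral_eq_of_transport hHm hBm hHb hBb htrH' (swap hidB)
    have hID : ∫ μ, D μ ∂P = ∫ μ, Dt μ ∂P :=
      integral_eq_of_transport hDm hDtm hDb hDtb' htrD hidD
    -- integrate the convexity inequality and `Dt ≤ 2V`
    have h1 : 4 * eStar - C / (2 * n + 1) + κ * ∫ μ, V μ ∂P ≤ (∫ μ, A μ ∂P) + ∫ μ, B μ ∂P := by
      have hfi : Integrable (fun μ => (4 * eStar - C / (2 * n + 1)) + κ * V μ) P :=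
        (integrable_const _).add (hVi.const_mul κ)
      have hgi : Integrable (fun μ => A μ + B μ) P := hAi.add hBi
      have := integral_mono_ae hfi hgi hconv
      rw [integral_add (integrable_const _) (hVi.const_mul κ), integral_add hAi hBi, integral_const,
        integral_const_mul, smul_eq_mul] at this
      simpa only [probReal_univ, one_mul] using this
    have h2 : ∫ μ, Dt μ ∂P ≤ 2 * ∫ μ, V μ ∂P := by
      rw [← integral_const_mul]
      exact integral_mono_ae hDti (hVi.const_mul 2) hDV
    -- conclude
    have hpos : (0 : ℝ) < 2 * n + 1 := by positivity
    have h3 : κ * ∫ μ, V μ ∂P ≤ C / (2 * n + 1) := by linarith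
    have h4 : ∫ μ, V μ ∂P ≤ (C / κ) / (2 * n + 1) := by
      rw [div_div, le_div_iff₀ (by positivity)]
      calc (∫ μ, V μ ∂P) * (κ * (2 * n + 1)) = (κ * ∫ μ, V μ ∂P) * (2 * n + 1) := by ring
        _ ≤ C / (2 * n + 1) * (2 * n + 1) := by gcongr
        _ = C := by field_simp
    rw [hID]
    calc ∫ μ, Dt μ ∂P ≤ 2 * ∫ μ, V μ ∂P := h2
      _ ≤ 2 * ((C / κ) / (2 * n + 1)) := by linarith
      _ = (2 * C / κ) / (2 * n + 1) := by ring
  exact lms_ae_zero_of_integral_le_div P hP D hDm K _ hDK hmean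

/-- **Mean increment argument, edge-tolerant form** (registered sub-goal `lms_increments_ae_zero'`):
as `lms_increments_ae_zero`, with the transported jump functional only required to satisfy
`Dt ≤ 2V + C/(2n+1)` (finitely many window-edge jumps are not covered by `V`). [folklore] -/
theorem lms_increments_ae_zero' : ∀ (δ : ℝ), 0 < δ → ∀ (P : Measure (Measure E3)), IsProbabilityMeasure P → IsMinimisingLaw δ P → ∀ (D : Measure E3 → ℝ), Measurable D → ∀ (K κ C : ℝ), 0 < κ → 0 ≤ C → (∀ᵐ μ ∂P, 0 ≤ D μ ∧ D μ ≤ K) → (∀ᵐ μ ∂P, |2 * rootEnergy lennardJones μ| ≤ K) → (∀ n : ℕ, ∃ (A B V Dt : Measure E3 → ℝ) (Ωr Ωs Ωr' Ωs' : Measure E3 → E3 → ℝ≥0∞), Measurable A ∧ Measurable B ∧ Measurable V ∧ Measurable Dt ∧ (∀ᵐ μ ∂P, |A μ| ≤ K) ∧ (∀ᵐ μ ∂P, |B μ| ≤ K) ∧ (∀ᵐ μ ∂P, 0 ≤ V μ ∧ V μ ≤ K) ∧ (∀ᵐ μ ∂P, 0 ≤ Dt μ ∧ Dt μ ≤ K)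 ∧ Measurable (Function.uncurry Ωr) ∧ (∀ᵐ μ ∂P, ∫⁻ y, Ωr μ y ∂μ = 1) ∧ (∀ᵐ μ ∂P, ∀ y : E3, μ {y} ≠ 0 → Ωr (μ.map (fun z => z - y)) (-y) = Ωs μ y) ∧ Measurable (Function.uncurry Ωr') ∧ (∀ᵐ μ ∂P, ∫⁻ y, Ωr' μ y ∂μ = 1) ∧ (∀ᵐ μ ∂P, ∀ y : E3, μ {y} ≠ 0 → Ωr' (μ.map (fun z => z - y)) (-y) = Ωs' μ y) ∧ (∀ᵐ μ ∂P, ∫⁻ y, Ωs μ y * ENNReal.ofReal (2 * rootEnergy lennardJones (μ.map (fun z => z - y)) + K) ∂μ = ENNReal.ofReal (A μ + K)) ∧ (∀ᵐ μ ∂P, ∫⁻ y, Ωs' μ y * ENNReal.ofReal (2 * rootEnergy lennardJones (μ.map (fun z => z - y)) + K) ∂μ = ENNReal.ofReal (B μ + K)) ∧ (∀ᵐ μ ∂P, ∫⁻ y, Ωs μ y * ENNReal.ofReal (D (μ.map (fun z => z - y)) + K) ∂μ = ENNReal.ofReal (Dt μ + K)) ∧ (∀ᵐ μ ∂P, 4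 * eStar - C / (2 * n + 1) + κ * V μ ≤ A μ + B μ) ∧ (∀ᵐ μ ∂P, Dt μ ≤ 2 * V μ + C / (2 * n + 1))) → ∀ᵐ μ ∂P, D μ = 0 := by
  intro δ hδ P hP hlaw D hDm K κ C hκ hC hDK hHK hT
  obtain ⟨hcore, hstat, hE⟩ := hlaw
  -- the doubled root energy as a bounded measurable functional
  set H : Measure E3 → ℝ := fun μ => 2 * rootEnergy' μ with hHdef
  have hHm : Measurable H := measurable_rootEnergy'.const_mul 2
  have hHeq : ∀ᵐ μ ∂P, H μ = 2 * rootEnergy lennardJones μ := by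
    filter_upwards [hcore] with μ hμ
    simp only [hHdef, rootEnergy'_eq_of_hc hδ hμ, rootEnergy_def]
  have hHb : ∀ᵐ μ ∂P, |H μ| ≤ K := by
    filter_upwards [hHeq, hHK] with μ h1 h2
    rwa [h1]
  have hHint : Integrable H P := integrable_of_abs_le hHm hHb
  have hHE : ∫ μ, H μ ∂P ≤ 2 * eStar := by
    rw [integral_congr_ae hHeq, integral_const_mul]
    linarith
  -- `H = 2h` also at every re-rooted sample (root-to-everywhere)
  have hHeq' : ∀ᵐ μ ∂P, ∀ y : E3, μ {y} ≠ 0 →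
      H (μ.map (fun z => z - y)) = 2 * rootEnergy lennardJones (μ.map (fun z => z - y)) := by
    have hlf : ∀ᵐ μ ∂P, ∀ n : ℕ, μ ((fun z : E3 => ⌊‖z‖⌋₊) ⁻¹' {n}) < ⊤ := by
      filter_upwards [hcore] with μ hc n
      obtain ⟨S, -, hsep, rfl⟩ := hc
      exact PalmUnimodularRigidity.count_restrict_floorNorm_preimage_lt_top hδ hsep n
    exact PalmUnimodularRigidity.ae_forall_map_sub_of_ae hstat hlf hHeq
  -- the mean of `D` decays like `1/(2n+1)`
  have hmean : ∀ n : ℕ, (∫ μ, D μ ∂P) ≤ (2 * C / κ + C) / (2 * n + 1) := by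
    intro n
    obtain ⟨A, B, V, Dt, Ωr, Ωs, Ωr', Ωs', hAm, hBm, hVm, hDtm, hAb, hBb, hVb, hDtb, hΩm, hbal, hcov,
      hΩm', hbal', hcov', hidA, hidB, hidD, hconv, hDV⟩ := hT n
    have hDb : ∀ᵐ μ ∂P, |D μ| ≤ K := by
      filter_upwards [hDK] with μ h; rw [abs_of_nonneg h.1]; exact h.2
    have hDtb' : ∀ᵐ μ ∂P, |Dt μ| ≤ K := by
      filter_upwards [hDtb] with μ h; rw [abs_of_nonneg h.1]; exact h.2
    have hVi : Integrable V P := integrable_of_abs_le hVm (M := K) (by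
      filter_upwards [hVb] with μ h; rw [abs_of_nonneg h.1]; exact h.2)
    have hAi : Integrable A P := integrable_of_abs_le hAm hAb
    have hBi : Integrable B P := integrable_of_abs_le hBm hBb
    have hDi : Integrable D P := integrable_of_abs_le hDm hDb
    have hDti : Integrable Dt P := integrable_of_abs_le hDtm hDtb'
    -- the three transport identities
    have htrH := lms_lintegral_eq_transport δ hδ P hstat hcore Ωr Ωs hΩm hbal hcov
      (fun μ => ENNReal.ofReal (H μ + K)) (ENNReal.measurable_ofReal.comp (hHm.add_const K))
    have htrH' := lms_lintegral_eq_transport δ hδ P hstat hcore Ωr' Ωs' hΩm' hbal' hcov'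
      (fun μ => ENNReal.ofReal (H μ + K)) (ENNReal.measurable_ofReal.comp (hHm.add_const K))
    have htrD := lms_lintegral_eq_transport δ hδ P hstat hcore Ωr Ωs hΩm hbal hcov
      (fun μ => ENNReal.ofReal (D μ + K)) (ENNReal.measurable_ofReal.comp (hDm.add_const K))
    -- identifications with `H` in place of `2h`
    have swap : ∀ {Ω : Measure E3 → E3 → ℝ≥0∞} {L : Measure E3 → ℝ},
        (∀ᵐ μ ∂P, ∫⁻ y, Ω μ y * ENNReal.ofReal (2 * rootEnergy lennardJones (μ.map (fun z => z - y)) + K) ∂μ =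
          ENNReal.ofReal (L μ + K)) →
        ∀ᵐ μ ∂P, ∫⁻ y, Ω μ y * ENNReal.ofReal (H (μ.map (fun z => z - y)) + K) ∂μ =
          ENNReal.ofReal (L μ + K) := by
      intro Ω L hid
      filter_upwards [hid, hHeq', hcore] with μ h1 h2 hc
      rw [← h1]
      obtain ⟨S, -, hsep, rfl⟩ := hc
      refine lintegral_count_restrict_congr
        (MinimiserShells.Negative.Rootedness.countable_of_separated hδ hsep) fun y hy => ?_
      rw [h2 y ((count_restrict_singleton_ne_zero_iff S y).2 hy)]
    have hIA : ∫ μ, H μ ∂P = ∫ μ, A μ ∂P :=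
      integral_eq_of_transport hHm hAm hHb hAb htrH (swap hidA)
    have hIB : ∫ μ, H μ ∂P = ∫ μ, B μ ∂P :=
      integral_eq_of_transport hHm hBm hHb hBb htrH' (swap hidB)
    have hID : ∫ μ, D μ ∂P = ∫ μ, Dt μ ∂P :=
      integral_eq_of_transport hDm hDtm hDb hDtb' htrD hidD
    -- integrate the convexity inequality and `Dt ≤ 2V`
    have h1 : 4 * eStar - C / (2 * n + 1) + κ * ∫ μ, V μ ∂P ≤ (∫ μ, A μ ∂P) + ∫ μ, B μ ∂P := by
      have hfi : Integrable (fun μ => (4 * eStar - C / (2 * n + 1)) + κ * V μ) P :=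
        (integrable_const _).add (hVi.const_mul κ)
      have hgi : Integrable (fun μ => A μ + B μ) P := hAi.add hBi
      have := integral_mono_ae hfi hgi hconv
      rw [integral_add (integrable_const _) (hVi.const_mul κ), integral_add hAi hBi, integral_const,
        integral_const_mul, smul_eq_mul] at this
      simpa only [probReal_univ, one_mul] using this
    have h2 : ∫ μ, Dt μ ∂P ≤ 2 * ∫ μ, V μ ∂P + C / (2 * n + 1) := by
      have hgi : Integrable (fun μ => 2 * V μ + C / (2 * n + 1)) P := (hVi.const_mul 2).add (integrable_const _)
      have := integral_mono_ae hDti hgi hDV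
      rw [integral_add (hVi.const_mul 2) (integrable_const _), integral_const_mul, integral_const,
        smul_eq_mul] at this
      simpa only [probReal_univ, one_mul] using this
    -- conclude
    have hpos : (0 : ℝ) < 2 * n + 1 := by positivity
    have h3 : κ * ∫ μ, V μ ∂P ≤ C / (2 * n + 1) := by linarith
    have h4 : ∫ μ, V μ ∂P ≤ (C / κ) / (2 * n + 1) := by
      rw [div_div, le_div_iff₀ (by positivity)]
      calc (∫ μ, V μ ∂P) * (κ * (2 * n + 1)) = (κ * ∫ μ, V μ ∂P) * (2 * n + 1) := by ring
        _ ≤ C / (2 * n + 1) * (2 * n + 1) := by gcongr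
        _ = C := by field_simp
    rw [hID]
    calc ∫ μ, Dt μ ∂P ≤ 2 * ∫ μ, V μ ∂P + C / (2 * n + 1) := h2
      _ ≤ 2 * ((C / κ) / (2 * n + 1)) + C / (2 * n + 1) := by linarith
      _ = (2 * C / κ + C) / (2 * n + 1) := by ring
  exact lms_ae_zero_of_integral_le_div P hP D hDm K _ hDK hmean

end Summit.AtomisticToContinuum.Crystallization.Theorems.SlackRigidityPricedFloorsProb

end
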